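/-
Copyright: statement-level skeleton of a published paper (lit-balaban cell, Phase-2 proof seat p13, gen 7). No proof
claims beyond what the kernel checks below.
-/
import Literature.MathematicalPhysics.QuantumFieldTheory.BalabanImbrieJaffe1984to88.BIJ88RandomWalk578
import Literature.MathematicalPhysics.QuantumFieldTheory.Balaban1983to89.B4Ineq110WalkRoute

/-!
# `BalabanImbrieJaffe1984to88.BIJ88RandomWalk578Concrete` — T. Bałaban, J. Imbrie, A. Jaffe, *Effective action and
cluster properties of the abelian Higgs model*, Commun. Math. Phys. **114** (1988) 257–315 [BalabanImbrieJaffe1988]: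
Sect. 5.7, **(5.7.8)** p. 291 — the expansion `G_j(Ω,u) = G_{j,loc}(Ω,u) + Σ_X G_j(Ω,X,u)` and its support clause
INSTANTIATED on the CONCRETE operators of [6] = [Balaban1983RegularityDecay]: the covariant operator
`H = −Δ_W + m² + aQ^*Q` (1.6) on a finite site set, its cube operators, the constructed partition of unity `h_j`
(`B4PartitionUnity22.hCube`) and the letters `a_j = h_jG_jh_j` (2.2), `b_j = K_jG_jh_j` (2.11) of the cell's
`Balaban1983to89.B4Eq213ConcreteWalk` («model instance»)

statement-level skeleton of published theorems with citation tags; proofs where landed; nothing here is a claim about the Yang–Mills mass gap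

PDF held: `paper:balaban1988-cmp114-bij-abelian-higgs-effective-action` (journal page = PDF page + 256); p. 291 [PDF 35]
read as an image; [6] `paper:balaban1983-cmp89-regularity-decay` (journal page = PDF page + 570), pp. 575–577.

CITATION HEADER (lean-in-tree rule).  Part of the lit-balaban TYPED SKELETON (HOME `run/shared/lean/pub/lit-balaban/`):
WHAT IS REPRODUCED = row **C2.Eq5.7.7-5.7.9** of `HOME/lit-balaban-r16/ROWS-C2-part2.md`, member **(5.7.8)**, the
MODEL INSTANCE of the companion `BIJ88RandomWalk578` (same seat, p263885: (5.7.8) `eq578` and the support clause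
`gX_support` for [6]'s letters as abstract kernels with LOCALITY and BLOCK-SUPPORT hypotheses) — here those hypotheses
are DISCHARGED for [6]'s actual operators, exactly as `B4Eq213ConcreteWalk.concrete_walk_decay_bound` (r01 g5) does for
the decay bound (2.22)/(2.30): locality from `B4Eq213Locality.mulH_hCube_mul_opK_eq_zero` (the *"obvious fact"* of [6]
p. 577), `H·G₀ = 1 − R` from `B4Eq26Locality.parametrix_identity_hCube` ((2.9)–(2.11)), the Neumann series (2.12) from
`‖R‖ < 1` (`B4Eq213ConcreteWalk.hasSum_neumann`), and — new here — the END-POINT SUPPORTS of the letters from the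
diagonal structure of the multiplication operators `h_j` (r01's `B4Ineq110WalkRoute.mulH_mul_apply`,
`mul_mulH_apply`, reused by name).  Unit
`lit-balaban-p13` (gen 7), owner r16 (C2 §5) / r01 (B4), referee ref-5.

THE PRINT (p. 291, verbatim): *"This is accomplished with a random walk expansion for G_j(Ω,u). Such an expansion is
given in [6]. … The result is the expansion G_j(Ω,u) = G_{j,loc}(Ω,u) + Σ_X G_j(Ω,X,u). (5.7.8)  Of course,
G_j(Ω,X,u; x₁,x₂) = 0 unless both x₁ and x₂ are in X."*

WHAT THIS MODULE PROVES (all in full).  Setting of `B4Eq213ConcreteWalk`: any finite site set `X` with positions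
`pos : X → ℝ^d`, colour index `κ`, the operator `H = covOp c m² a q W T` with data local at scale `M/8`, its inverse `G`
(`G·H = 1`) — this is [6]'s `G_k(Ω,A)`, `Ω` = the site set, `A` = the link data `W, T` —, labels `j ∈ s ⊇ {j : h_j ≠ 0}`,
cube operators (Neumann cut at `S_j`, localized links `W′_j, T′_j` = the `Ã_j`) with inverses `G_j`, letters
`a_j = h_jG_jh_j`, `b_j = K_jG_jh_j`.
* `aJ_row`, `aJ_col`, `bJ_col` — rows and columns of `a_j` and columns of `b_j` vanish off `supp h_j` (the block `□_j`).
* **`eq578_concrete`** — (5.7.8) `BIJ88Sect2Statements.Eq245 G G_loc G_X` for THESE letters, for every label-to-site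
  distance `ldist`, radius `ρ`, cube map `cubeOf`, cube adjacency `cadj`; remaining hypotheses = the analytic inputs of
  [6] pp. 577–581, explicit as in r01's file: `‖R‖ < 1`, `‖a_j‖ ≤ α`, `‖b_j‖ ≤ β`, `3^dβ < 1`.
* **`support_concrete`** — *"G_j(Ω,X,u; x₁,x₂) = 0 unless both x₁ and x₂ are in X"* with *"x in X"* = `x` lies in a
  block `supp h_j` whose cube closure is inside `X` (`BIJ88RandomWalk242.memX`), NO analytic hypothesis.
* `letters_congr_of_cube_data` + **`gX_concrete_congr`** — *"The dependence on u is in X only"* for these letters: two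
  link data `(W,T)`, `(W₂,T₂)` (two backgrounds `u, u′`) whose LOCALIZED cube data coincide at the labels of `X`
  (`W′_j = W₂′_j`, `T′_j = T₂′_j`, same cut) have the same letters there (inverses are unique), hence the same `G_X`.
HONEST SCOPE.  Not proved here: [6]'s Lemma 2.1 (the sizes `α, β`), `‖R‖ < 1`, the choice of `M`; the Ω-independence
clause needs two site sets and is left at the abstract `BIJ88RandomWalk578.gLoc_congr`.  No `def`, no `Prop` fact, no
`sorry`; axioms standard.
-/

namespace Literature.MathematicalPhysics.QuantumFieldTheory.BalabanImbrieJaffe1984to88.BIJ88RandomWalk578Concrete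

open Literature.MathematicalPhysics.QuantumFieldTheory.Balaban1983to89
open B4GaugeCovariance B4Commutators25to211 B4PartitionUnity22 B4RandomWalk213 B4Eq213Locality B4Eq26Locality
  B4Eq213ConcreteWalk B4Ineq110WalkRoute
open BIJ88RandomWalk242 BIJ88RandomWalk578
open scoped Matrix Matrix.Norms.Operator

variable {X Y κ : Type*} [Fintype X] [Fintype Y] [Fintype κ] [DecidableEq X] [DecidableEq κ] {d : ℕ}

/-! ## §1 End-point supports of [6]'s letters (the multiplication operators `h_j` are diagonal) -/

omit [Fintype Y] in
/-- ROWS of `a_j = h_jG_jh_j` vanish off `supp h_j` (the block `□_j`: *"□_j is a cube of the size 2M and with center in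
Mj"*, [6] p. 575). [cite: BalabanImbrieJaffe1988, (5.7.8) p.291] -/
theorem aJ_row (h : X → ℝ) (Gm : Matrix (X × κ) (X × κ) ℝ) {p : X × κ} (hp : h p.1 = 0) (z : X × κ) :
    (mulH (ι := κ) h * Gm * mulH (ι := κ) h) p z = 0 := by
  rw [mul_mulH_apply, mulH_mul_apply, hp, zero_mul, zero_mul]

omit [Fintype Y] in
/-- COLUMNS of `a_j = h_jG_jh_j` vanish off `supp h_j`. [cite: BalabanImbrieJaffe1988, (5.7.8) p.291] -/
theorem aJ_col (h : X → ℝ) (Gm : Matrix (X × κ) (X × κ) ℝ) {p : X × κ} (hp : h p.1 = 0) (z : X × κ) :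
    (mulH (ι := κ) h * Gm * mulH (ι := κ) h) z p = 0 := by
  rw [mul_mulH_apply, hp, mul_zero]

omit [Fintype Y] in
/-- COLUMNS of `b_j = K_jG_jh_j` vanish off `supp h_j` (the right factor `h_j`). [cite: BalabanImbrieJaffe1988, (5.7.8) p.291] -/
theorem bJ_col (K Gm : Matrix (X × κ) (X × κ) ℝ) (h : X → ℝ) {p : X × κ} (hp : h p.1 = 0) (z : X × κ) :
    (K * Gm * mulH (ι := κ) h) z p = 0 := by
  rw [mul_mulH_apply, hp, mul_zero]

/-! ## §2 (5.7.8) for [6]'s concrete operators -/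

/-- **(5.7.8) FOR [6]'s CONCRETE `G_k(Ω,A)`** («model instance»).  Setting of `B4Eq213ConcreteWalk.concrete_walk_decay_bound`
(finite site set `X`, positions `pos`, `H = −Δ_W + m² + aQ^*Q` with data local at scale `M/8`, `G·H = 1`, labels
`j ∈ s ⊇ supp`, cube operators with inverses `G_j`, letters `a_j = h_jG_jh_j`, `b_j = K_jG_jh_j`); locality, `H·G₀ = 1 − R`
and the Neumann series DISCHARGED there and reused; remaining hypotheses = [6]'s analytic inputs, explicit: `‖R‖ < 1`,
`‖a_j‖ ≤ α`, `‖b_j‖ ≤ β`, `3^dβ < 1`.  CONCLUSION: for every label-to-site distance `ldist`, radius `ρ` (the print's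
`O(L^{k−j}r(e_k))`), cube map `cubeOf` (the `L^{k−j}r(e_k)`-cubes) and adjacency `cadj`, the kernel of `G` IS its local part
plus the sum of its `X`-parts: `BIJ88Sect2Statements.Eq245 G G_loc G_X` with `G_loc = cLoc …`, `G_X = cX …` built from
the kernels of the walk terms `a_{ω₀}b_{ω₁}⋯b_{ω_n}` of (2.13) — *"G_j(Ω,u) = G_{j,loc}(Ω,u) + Σ_X G_j(Ω,X,u) (5.7.8)"*.
[cite: BalabanImbrieJaffe1988, (5.7.8) p.291] -/
theorem eq578_concrete {M : ℝ} (hM : 0 < M) (pos : X → Fin d → ℝ) (c : X → X → ℝ) (m2 a : ℝ)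
    (q : Y → X → ℝ) (W : X → X → Matrix κ κ ℝ) (T : Y → X → Matrix κ κ ℝ)
    (hc : ∀ x z', c x z' ≠ 0 → ∀ μ, |pos x μ - pos z' μ| ≤ 1 / 8 * M)
    (hq : ∀ y x z', q y x ≠ 0 → q y z' ≠ 0 → ∀ μ, |pos x μ - pos z' μ| ≤ 1 / 8 * M)
    (s : Finset (Fin d → ℤ)) (hs : ∀ j x, hCube M j (pos x) ≠ 0 → j ∈ s)
    (S : (Fin d → ℤ) → X → Prop) [∀ j, DecidablePred (S j)]
    (hS : ∀ j z, (∀ μ, |pos z μ - M * j μ| ≤ 7 / 8 * M) → S j z)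
    (W' : (Fin d → ℤ) → X → X → Matrix κ κ ℝ) (T' : (Fin d → ℤ) → Y → X → Matrix κ κ ℝ)
    (hWW' : ∀ j x z', (∀ μ, |pos x μ - M * j μ| ≤ 3 / 4 * M) → (∀ μ, |pos z' μ - M * j μ| ≤ 3 / 4 * M) →
      W' j x z' = W x z')
    (hTT' : ∀ j y x, q y x ≠ 0 → (∀ μ, |pos x μ - M * j μ| ≤ 3 / 4 * M) → T' j y x = T y x)
    (Gj : (Fin d → ℤ) → Matrix (X × κ) (X × κ) ℝ)
    (hGj : ∀ j ∈ s, covOp (fun z z' => if (S j z ↔ S j z') then c z z' else 0) m2 a q (W' j) (T' j) * Gj j = 1)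
    (G : Matrix (X × κ) (X × κ) ℝ) (hGH : G * covOp c m2 a q W T = 1)
    -- the analytic inputs
    (hR : ‖∑ j ∈ s, opK (fun z z' => if (S j z ↔ S j z') then c z z' else 0) m2 a q (W' j) (T' j)
        (fun z => hCube M j (pos z)) * Gj j * mulH (ι := κ) (fun z => hCube M j (pos z))‖ < 1)
    {α β : ℝ}
    (hα : ∀ i : ↥s,
      ‖mulH (ι := κ) (fun z => hCube M i.1 (pos z)) * Gj i.1 * mulH (ι := κ) (fun z => hCube M i.1 (pos z))‖ ≤ α)
    (hβ : ∀ i : ↥s, ‖opK (fun z z' => if (S i.1 z ↔ S i.1 z') then c z z' else 0) m2 a q (W' i.1) (T' i.1)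
        (fun z => hCube M i.1 (pos z)) * Gj i.1 * mulH (ι := κ) (fun z => hCube M i.1 (pos z))‖ ≤ β)
    (h3β : (3 : ℝ) ^ d * β < 1)
    {κ' : Type*} [Fintype κ'] [DecidableEq κ'] (ldist : ↥s → X × κ → ℝ) (ρ : ℝ) (cubeOf : ↥s → κ')
    (cadj : κ' → κ' → Prop) :
    BIJ88Sect2Statements.Eq245 (fun p p' => G p p')
      (cLoc ldist ρ fun ω p p' => walkTerm
        (fun i : ↥s => mulH (ι := κ) (fun z => hCube M i.1 (pos z)) * Gj i.1 * mulH (ι := κ) (fun z => hCube M i.1 (pos z)))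
        (fun i : ↥s => opK (fun z z' => if (S i.1 z ↔ S i.1 z') then c z z' else 0) m2 a q (W' i.1) (T' i.1)
          (fun z => hCube M i.1 (pos z)) * Gj i.1 * mulH (ι := κ) (fun z => hCube M i.1 (pos z))) ω p p')
      (cX ldist ρ cubeOf cadj fun ω p p' => walkTerm
        (fun i : ↥s => mulH (ι := κ) (fun z => hCube M i.1 (pos z)) * Gj i.1 * mulH (ι := κ) (fun z => hCube M i.1 (pos z)))
        (fun i : ↥s => opK (fun z z' => if (S i.1 z ↔ S i.1 z') then c z z' else 0) m2 a q (W' i.1) (T' i.1)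
          (fun z => hCube M i.1 (pos z)) * Gj i.1 * mulH (ι := κ) (fun z => hCube M i.1 (pos z))) ω p p') := by
  -- the letters of `B4RandomWalk213` for the concrete data (as in `B4Eq213ConcreteWalk.concrete_walk_decay_bound`)
  set h : (Fin d → ℤ) → X → ℝ := fun j z => hCube M j (pos z) with hh
  set cut : (Fin d → ℤ) → X → X → ℝ := fun j z z' => if (S j z ↔ S j z') then c z z' else 0 with hcut
  set aJ : (Fin d → ℤ) → Matrix (X × κ) (X × κ) ℝ :=
    fun j => mulH (ι := κ) (h j) * Gj j * mulH (ι := κ) (h j) with haJ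
  set bJ : (Fin d → ℤ) → Matrix (X × κ) (X × κ) ℝ :=
    fun j => opK (cut j) m2 a q (W' j) (T' j) (h j) * Gj j * mulH (ι := κ) (h j) with hbJ
  -- (2.9)–(2.11): `H·G₀ = 1 − R`, hence (2.12) `G(1 − R) = G₀`
  have h211 : covOp c m2 a q W T * ∑ j ∈ s, aJ j = 1 - ∑ j ∈ s, bJ j :=
    parametrix_identity_hCube hM pos c m2 a q W T s hs S hS hc hq W' T' hWW' hTT' Gj hGj
  have hGeq : G * (1 - ∑ j ∈ s, bJ j) = ∑ j ∈ s, aJ j := G_mul_one_sub_eq hGH h211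
  -- locality of the cube data at scale `(3/4)M` (verbatim from `B4Eq213ConcreteWalk`)
  have hM8 : 1 / 8 * M ≤ 3 / 4 * M := by nlinarith
  have hcut_loc : ∀ l z z', cut l z z' ≠ 0 → ∀ μ, |pos z μ - pos z' μ| ≤ 3 / 4 * M :=
    fun l z z' hne μ => (cut_local pos c (S l) hc z z' hne μ).trans hM8
  have hq_loc : ∀ y z z', q y z ≠ 0 → q y z' ≠ 0 → ∀ μ, |pos z μ - pos z' μ| ≤ 3 / 4 * M :=
    fun y z z' h1 h2 μ => (hq y z z' h1 h2 μ).trans hM8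
  have hloc : ∀ i l : ↥s, ¬ cubeAdj (fun i : ↥s => i.1) i l →
      mulH (ι := κ) (h i.1) * opK (cut l.1) m2 a q (W' l.1) (T' l.1) (h l.1) = 0 :=
    fun i l hil => mulH_hCube_mul_opK_eq_zero hM pos (cut l.1) m2 a q (W' l.1) (T' l.1) (hcut_loc l.1) hq_loc hil
  have hab : ∀ i l : ↥s, ¬ cubeAdj (fun i : ↥s => i.1) i l → aJ i.1 * bJ l.1 = 0 := by
    intro i l hil
    simp only [haJ, hbJ]
    rw [show mulH (ι := κ) (h i.1) * Gj i.1 * mulH (ι := κ) (h i.1)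
          * (opK (cut l.1) m2 a q (W' l.1) (T' l.1) (h l.1) * Gj l.1 * mulH (ι := κ) (h l.1))
        = mulH (ι := κ) (h i.1) * Gj i.1
          * (mulH (ι := κ) (h i.1) * opK (cut l.1) m2 a q (W' l.1) (T' l.1) (h l.1))
          * Gj l.1 * mulH (ι := κ) (h l.1) by simp only [Matrix.mul_assoc],
      hloc i l hil, Matrix.mul_zero, Matrix.zero_mul, Matrix.zero_mul]
  have hbb : ∀ i l : ↥s, ¬ cubeAdj (fun i : ↥s => i.1) i l → bJ i.1 * bJ l.1 = 0 := by
    intro i l hil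
    simp only [hbJ]
    rw [show opK (cut i.1) m2 a q (W' i.1) (T' i.1) (h i.1) * Gj i.1 * mulH (ι := κ) (h i.1)
          * (opK (cut l.1) m2 a q (W' l.1) (T' l.1) (h l.1) * Gj l.1 * mulH (ι := κ) (h l.1))
        = opK (cut i.1) m2 a q (W' i.1) (T' i.1) (h i.1) * Gj i.1
          * (mulH (ι := κ) (h i.1) * opK (cut l.1) m2 a q (W' l.1) (T' l.1) (h l.1))
          * Gj l.1 * mulH (ι := κ) (h l.1) by simp only [Matrix.mul_assoc],
      hloc i l hil, Matrix.mul_zero, Matrix.zero_mul, Matrix.zero_mul]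
  -- the sums over the finite label type `↥s`
  have hsumA : ∑ i : ↥s, aJ i.1 = ∑ j ∈ s, aJ j := Finset.sum_coe_sort s aJ
  have hsumB : ∑ i : ↥s, bJ i.1 = ∑ j ∈ s, bJ j := Finset.sum_coe_sort s bJ
  have hR' : ‖∑ i : ↥s, bJ i.1‖ < 1 := by rw [hsumB]; exact hR
  have hG' : G * (1 - ∑ i : ↥s, bJ i.1) = ∑ i : ↥s, aJ i.1 := by rw [hsumA, hsumB]; exact hGeq
  have h3β' : ((3 ^ d : ℕ) : ℝ) * β < 1 := by exact_mod_cast h3β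
  exact eq578 (cubeAdj fun i : ↥s => i.1) (a := fun i : ↥s => aJ i.1) (b := fun i : ↥s => bJ i.1) hab hbb hα hβ
    (card_cubeAdj_le (fun i : ↥s => i.1) Subtype.val_injective) h3β' hR' hG' ldist ρ cubeOf cadj

/-! ## §3 *"Of course, G_j(Ω,X,u; x₁,x₂) = 0 unless both x₁ and x₂ are in X"* for [6]'s concrete operators -/

omit [Fintype Y] in
/-- **THE SUPPORT CLAUSE FOR [6]'s CONCRETE LETTERS**, no analytic hypothesis: with `a_j = h_jG_jh_j`, `b_j = K_jG_jh_j`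
for ANY cube Green's functions `G_j` and commutators `K_j`, the `X`-part built from the walk terms of (2.13) vanishes at
`(x₁,x₂)` unless `x₁` and `x₂` each lie in a block `supp h_j` whose cube closure is inside `X` (`BIJ88RandomWalk242.memX`
with `blk x j := h_j(x) ≠ 0`) — *"G_j(Ω,X,u; x₁,x₂) = 0 unless both x₁ and x₂ are in X"*.
[cite: BalabanImbrieJaffe1988, (5.7.8) p.291] -/
theorem support_concrete (M : ℝ) (pos : X → Fin d → ℝ) (s : Finset (Fin d → ℤ))
    (Kj Gj : (Fin d → ℤ) → Matrix (X × κ) (X × κ) ℝ)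
    {κ' : Type*} [Fintype κ'] [DecidableEq κ'] (ldist : ↥s → X × κ → ℝ) (ρ : ℝ) (cubeOf : ↥s → κ')
    (cadj : κ' → κ' → Prop) :
    ∀ Xc p p', ¬ (memX (fun (x : X × κ) (j : ↥s) => hCube M j.1 (pos x.1) ≠ 0) cubeOf cadj p Xc ∧
        memX (fun (x : X × κ) (j : ↥s) => hCube M j.1 (pos x.1) ≠ 0) cubeOf cadj p' Xc) →
      cX ldist ρ cubeOf cadj (fun ω p p' => walkTerm
        (fun i : ↥s => mulH (ι := κ) (fun z => hCube M i.1 (pos z)) * Gj i.1 * mulH (ι := κ) (fun z => hCube M i.1 (pos z)))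
        (fun i : ↥s => Kj i.1 * Gj i.1 * mulH (ι := κ) (fun z => hCube M i.1 (pos z))) ω p p') Xc p p' = 0 :=
  gX_support (fun (x : X × κ) (j : ↥s) => hCube M j.1 (pos x.1) ≠ 0)
    (a := fun i : ↥s => mulH (ι := κ) (fun z => hCube M i.1 (pos z)) * Gj i.1 * mulH (ι := κ) (fun z => hCube M i.1 (pos z)))
    (b := fun i : ↥s => Kj i.1 * Gj i.1 * mulH (ι := κ) (fun z => hCube M i.1 (pos z)))
    (fun _ _ hx => aJ_row _ _ (not_not.mp hx)) (fun _ _ hx => aJ_col _ _ (not_not.mp hx))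
    (fun _ _ hx => bJ_col _ _ _ (not_not.mp hx)) ldist ρ cubeOf cadj

/-! ## §4 *"The dependence on u is in X only"* for [6]'s concrete letters -/

/-- **LETTERS ARE DETERMINED BY THE CUBE DATA** ([6] p. 577: `G_k(□_j,Ã_j)` is the inverse of the cube operator):
two backgrounds whose localized cube data at label `j` coincide (`W′_j = W₂′_j`, `T′_j = T₂′_j`, same Neumann cut, same
`h_j`) have the same cube Green's function (a right inverse of an invertible matrix is unique) and hence the same letters
`a_j`, `b_j`. [cite: BalabanImbrieJaffe1988, (5.7.8) p.291] -/
theorem letters_congr_of_cube_data (cutj : X → X → ℝ) (m2 a : ℝ) (q : Y → X → ℝ)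
    {Wj W₂j : X → X → Matrix κ κ ℝ} {Tj T₂j : Y → X → Matrix κ κ ℝ} (hW : Wj = W₂j) (hT : Tj = T₂j)
    (hj : X → ℝ) {Gm G₂m : Matrix (X × κ) (X × κ) ℝ} (hG : covOp cutj m2 a q Wj Tj * Gm = 1)
    (hG₂ : covOp cutj m2 a q W₂j T₂j * G₂m = 1) :
    mulH (ι := κ) hj * Gm * mulH (ι := κ) hj = mulH (ι := κ) hj * G₂m * mulH (ι := κ) hj ∧
      opK cutj m2 a q Wj Tj hj * Gm * mulH (ι := κ) hj = opK cutj m2 a q W₂j T₂j hj * G₂m * mulH (ι := κ) hj := by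
  subst hW hT
  have hGG : Gm = G₂m := by
    have h1 : Gm * covOp cutj m2 a q Wj Tj = 1 := mul_eq_one_comm.mp hG
    calc Gm = Gm * (covOp cutj m2 a q Wj Tj * G₂m) := by rw [hG₂, Matrix.mul_one]
      _ = G₂m := by rw [← Matrix.mul_assoc, h1, Matrix.one_mul]
  rw [hGG]
  exact ⟨rfl, rfl⟩

/-- **"The dependence on u is in X only" FOR [6]'s CONCRETE LETTERS**: two backgrounds `u, u′` (link data `(W′,T′)`,
`(W₂′,T₂′)` localized per label, same cuts, cube Green's functions `G_j`, `G₂,j`) whose cube data COINCIDE AT THE LABELS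
OF `X` (`W′_j = W₂′_j`, `T′_j = T₂′_j` whenever `cubeOf j ∈ X`) give the same `X`-part `G_j(Ω,X,·)` at every pair of sites
(`BIJ88RandomWalk578.gX_congr` + `letters_congr_of_cube_data`). [cite: BalabanImbrieJaffe1988, (5.7.8) p.291] -/
theorem gX_concrete_congr (M : ℝ) (pos : X → Fin d → ℝ) (cut : (Fin d → ℤ) → X → X → ℝ) (m2 a : ℝ) (q : Y → X → ℝ)
    (s : Finset (Fin d → ℤ)) (W' W₂' : (Fin d → ℤ) → X → X → Matrix κ κ ℝ) (T' T₂' : (Fin d → ℤ) → Y → X → Matrix κ κ ℝ)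
    (Gj G₂j : (Fin d → ℤ) → Matrix (X × κ) (X × κ) ℝ)
    (hGj : ∀ j ∈ s, covOp (cut j) m2 a q (W' j) (T' j) * Gj j = 1)
    (hG₂j : ∀ j ∈ s, covOp (cut j) m2 a q (W₂' j) (T₂' j) * G₂j j = 1)
    {κ' : Type*} [Fintype κ'] [DecidableEq κ'] (ldist : ↥s → X × κ → ℝ) (ρ : ℝ) (cubeOf : ↥s → κ')
    (cadj : κ' → κ' → Prop) {Xc : Finset κ'} (hW : ∀ i : ↥s, cubeOf i ∈ Xc → W' i.1 = W₂' i.1)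
    (hT : ∀ i : ↥s, cubeOf i ∈ Xc → T' i.1 = T₂' i.1) (p p' : X × κ) :
    cX ldist ρ cubeOf cadj (fun ω p p' => walkTerm
        (fun i : ↥s => mulH (ι := κ) (fun z => hCube M i.1 (pos z)) * Gj i.1 * mulH (ι := κ) (fun z => hCube M i.1 (pos z)))
        (fun i : ↥s => opK (cut i.1) m2 a q (W' i.1) (T' i.1) (fun z => hCube M i.1 (pos z)) * Gj i.1 *
          mulH (ι := κ) (fun z => hCube M i.1 (pos z))) ω p p') Xc p p' =
      cX ldist ρ cubeOf cadj (fun ω p p' => walkTerm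
        (fun i : ↥s => mulH (ι := κ) (fun z => hCube M i.1 (pos z)) * G₂j i.1 * mulH (ι := κ) (fun z => hCube M i.1 (pos z)))
        (fun i : ↥s => opK (cut i.1) m2 a q (W₂' i.1) (T₂' i.1) (fun z => hCube M i.1 (pos z)) * G₂j i.1 *
          mulH (ι := κ) (fun z => hCube M i.1 (pos z))) ω p p') Xc p p' :=
  gX_congr
    (a := fun i : ↥s => mulH (ι := κ) (fun z => hCube M i.1 (pos z)) * Gj i.1 * mulH (ι := κ) (fun z => hCube M i.1 (pos z)))
    (b := fun i : ↥s => opK (cut i.1) m2 a q (W' i.1) (T' i.1) (fun z => hCube M i.1 (pos z)) * Gj i.1 *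
      mulH (ι := κ) (fun z => hCube M i.1 (pos z)))
    (a' := fun i : ↥s => mulH (ι := κ) (fun z => hCube M i.1 (pos z)) * G₂j i.1 * mulH (ι := κ) (fun z => hCube M i.1 (pos z)))
    (b' := fun i : ↥s => opK (cut i.1) m2 a q (W₂' i.1) (T₂' i.1) (fun z => hCube M i.1 (pos z)) * G₂j i.1 *
      mulH (ι := κ) (fun z => hCube M i.1 (pos z)))
    ldist ρ cubeOf cadj
    (fun i hi => (letters_congr_of_cube_data (cut i.1) m2 a q (hW i hi) (hT i hi) _ (hGj i.1 i.2) (hG₂j i.1 i.2)).1)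
    (fun i hi => (letters_congr_of_cube_data (cut i.1) m2 a q (hW i hi) (hT i hi) _ (hGj i.1 i.2) (hG₂j i.1 i.2)).2)
    p p'

end Literature.MathematicalPhysics.QuantumFieldTheory.BalabanImbrieJaffe1984to88.BIJ88RandomWalk578Concrete
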